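import Summits.HodgeConjecture.HodgeConjecture.Theorems.Ring2HypothesesWeilComponentsSplit
import Summits.HodgeConjecture.HodgeConjecture.Theorems.Ring2AbelianAllWeilSignCells
import Literature.AlgebraicGeometry.VanGeemen1994.HyperbolicOfSplitDiscriminant
import HarnessLib

/-!
# Ring 2 · AbelianAll (seat `ab-weil-2`, gen 3) — Landherr's converse is a THEOREM: the node
  `LandherrHyperbolicOfSplitDiscriminant` (hence `LandherrSplitCriterion`) DISCHARGED

HONEST FRAMING (sub-cell `pub-hodge-ring2-ab-*`, verbatim): research route, not a corollary; conditional on HC_CM plus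
one named minimal statement. (Cell `pub-hodge-ring2`, verbatim: research route conditional on HC_CM; not a corollary;
Q11.4-sentence-2 already refuted in dim ≥ 3.) `HC_CM` (`Theses.RankFourFaces.CMAbelianHodge`) does not occur in this
file; no open case of the Hodge conjecture is claimed; no definition, no named fact, no `sorry`.

WHAT IS DISCHARGED. The cell's typed print obligation `Ring2.Hypotheses.LandherrSplitCriterion` (typer 2, part VII-B
`Ring2HypothesesWeilComponentsLadder` §4: van Geemen LNM 1594 (5.4.1) after Landherr 1936 — for a Weil-type `(A, φ)`
of dimension `2n` and its `K`-symmetrised hyperplane class `h_K = d·e^*a + φ^*e^*a`, "`(A, φ)` is HYPERBOLIC for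
`h_K` iff `det H = (-1)ⁿ` in `ℚ^×/Nm(K^×)` with `H` non-degenerate") and its converse half
`Ring2.Hypotheses.LandherrHyperbolicOfSplitDiscriminant` (typer 2, part XXVIII `Ring2HypothesesWeilComponentsSplit`
§5, "what remains of the binder"; the forward half is lit's `VanGeemen1994.hasWeilDiscriminantNondeg_neg_one_pow_of_isHyperbolicWeilType`).
Both are now THEOREMS of the tree: `landherrHyperbolicOfSplitDiscriminant_holds`, `landherrSplitCriterion_holds`.

THE PROOF (all Literature, all proved; summary). (1) ABSTRACT LANDHERR for van Geemen's Hermitian form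
`H = E(·, α·) + α E(·,·)` on a `K`-space, `K = ℚ(α)`, `α² = -d`: signature `(n, n)` and `det H = [(-1)ⁿ]` give Witt
index `n` — `Motives.exists_lagrangian_of_weilDiscriminant_eq` (`Literature/…/Motives/WeilHermitianLandherr`, by
induction on `n`: split off a hyperbolic plane with signature control, `Motives.exists_weil_hyperbolic_split`, whose
isotropic vector comes from MEYER'S THEOREM = the tree's PROVED `Literature.NumberTheory.QuadraticForms.meyer_holds`;
divide the discriminant by `[-1]`, `Motives.weilDiscriminant_eq_neg_mul_of_hyperbolicPlane`; the base is the binary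
case `[ab] = [-1] ⟹ ⟨a⟩ ⊥ ⟨b⟩ isotropic`, `Motives.exists_isotropic_line_of_weilDiscriminant`). (2) ON THE CARRIERS
(`VanGeemen1994.isHyperbolicWeilType_of_hasWeilDiscriminantNondeg_split`): a `HasWeilDiscriminantNondeg` witness
`(x, ω, a, b, q)` IS a rational degree-one model `(x, φ^*x)` of `(A, φ, h_K)` with `K_d`-Gram matrix `Ψ = a + b√-d`;
its signature is `(n, n)` by Hodge–Riemann in degree one for `h_K` and the multiplicities `(n, n)` of the Weil class
(`Motives.weilSignature_exists_PN`); Landherr in coordinates (`Motives.exists_lagrangian_coords_of_weilGram_det`) and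
`Motives.isHyperbolicWeilType_of_rationalModel` give the hyperbolic frame.

CONSEQUENCES FILED HERE (one-liners; every row of the cell displaying `(hL : LandherrSplitCriterion)` or
`(hL' : LandherrHyperbolicOfSplitDiscriminant)` — typer 2 VII-B/XIII/XXVIII/XXIX, ab-weil-1 Floor/Squarefree/SignCells/
FloorRebase, ab-andre-1 WeilFloor, habitat `…RefereedFourfolds`, typer 1 FrameRankFour, typer 2 WeilPowers — is now
dischargeable by ONE TERM; the owners re-base their own files, this file re-exports the node's own rows):
* `splitWeilAbelianVarieties_iff_split_components'` — W4 EXACT and FACT-FREE: rung R2 `SplitWeilAbelianVarieties` ⟺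
  all split cells `(n, d, (-1)ⁿ)`, `n ≥ 4`;
* `hyperbolicSixfolds_iff_split_components'` — F2 (`Markman2025_…_hyperbolicSixfold`) ⟺ all cells `(3, d, -1)`, fact-free;
* `weilClassesComponent_split_two_of_markman2023'` / `…_three_three_of_schoen'` / `…_three_one_of_koike'` — the refereed
  split cells `(2, d, +1)`, `(3, 3, -1)`, `(3, 1, -1)` from ONE refereed named fact each (Markman JEMS 2023 Thm. 1.3;
  Schoen 1998; Koike 2004), no Landherr binder;
* `nonsplitSixfolds_of_negative_nonsplit_components'` — ab-weil-1's R1′ row (`Ring2AbelianAllWeilSignCells`) with its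
  `hL'` discharged: `NonsplitSixfolds` ⟸ the NEGATIVE non-split sixfold cells alone;
* `isSplitWeilType_iff_exists_hasWeilDiscriminantNondeg_split` — for `(A, φ)` of Weil type `(n, d)`:
  SPLIT Weil type ⟺ some `K`-symmetrised hyperplane class has non-degenerate discriminant `[(-1)ⁿ]` (van Geemen
  (5.4.1) as an `↔` on the tree's predicates `HodgeTheory.IsSplitWeilType` / `VanGeemen1994.HasWeilDiscriminantNondeg`).

## References

* [vanGeemen1994HodgeAV] B. van Geemen, An introduction to the Hodge conjecture for abelian varieties, LNM 1594 (1994),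
  Lemma 5.2 (2)–(4), 5.4 and (5.4.1).
* [Landherr1936HermitianForms] W. Landherr, Abh. Math. Sem. Hamburg 11 (1936) 245–248.
* [Deligne1982HodgeCycles] P. Deligne, Hodge cycles on abelian varieties, LNM 900 (1982), §4 Prop. 4.1, Cor. 4.2.
* [Serre1973] J.-P. Serre, A Course in Arithmetic, Ch. IV §3.2 Cor. 2 (Meyer).
* [Markman2023GeneralizedKummers] E. Markman, JEMS 25 (2023), Thm. 1.3. [Schoen1998HodgeWeilAddendum] C. Schoen,
  Compositio 114 (1998). [Koike2004WeilHodge] K. Koike (2004), Thm. 2.1, Cor. 2.1.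
  [Markman2025SecantWeil] E. Markman, arXiv:2502.03415 (unrefereed), Thm. 1.5.1.
-/

set_option linter.dupNamespace false

noncomputable section

open CategoryTheory

namespace Summit.HodgeConjecture.HodgeConjecture.Ring2.AbelianAll

open Literature.AlgebraicGeometry Literature.AlgebraicGeometry.Motives
open Literature.AlgebraicGeometry.HodgeTheory Literature.AlgebraicGeometry.VanGeemen1994
open Literature.AlgebraicTopology.SingularHomology
open Summit.HodgeConjecture.HodgeConjecture.WeilTypeLadder
open Summit.HodgeConjecture.HodgeConjecture.Theses
open Summit.HodgeConjecture.HodgeConjecture.Ring2.Hypotheses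

/-! ## §1 The node, discharged -/

/-- **`LandherrHyperbolicOfSplitDiscriminant` HOLDS** (typer 2, XXVIII §5 — the converse half of Landherr's criterion
on the carriers: a Weil-type `(A, φ)` of dimension `2n` with `det H = [(-1)ⁿ]` for `h_K = d·e^*a + φ^*e^*a`, `H`
non-degenerate, is HYPERBOLIC for `h_K`). The term is the Literature theorem
`VanGeemen1994.isHyperbolicWeilType_of_hasWeilDiscriminantNondeg_split` (Landherr via Meyer, all proved in the tree).
[cite: vanGeemen1994HodgeAV, 5.4 and (5.4.1)] [cite: Landherr1936HermitianForms] [cite: Deligne1982HodgeCycles, §4 Cor. 4.2] -/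
theorem landherrHyperbolicOfSplitDiscriminant_holds : LandherrHyperbolicOfSplitDiscriminant :=
  fun _ _ hn hd _ _ hA hφ e _ ha ha0 hc hδ ↦
    isHyperbolicWeilType_of_hasWeilDiscriminantNondeg_split hn hA hd hφ e ha ha0 hc hδ

/-- **`LandherrSplitCriterion` HOLDS** (typer 2, VII-B §4: van Geemen (5.4.1) after Landherr 1936, as an `↔` on the
carriers) — by XXVIII's `landherrSplitCriterion_of_hyperbolicOfSplitDiscriminant` from the converse half just proved
and the forward half `hasWeilDiscriminantNondeg_neg_one_pow_of_isHyperbolicWeilType`.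
[cite: vanGeemen1994HodgeAV, 5.4 and (5.4.1)] [cite: Landherr1936HermitianForms] -/
theorem landherrSplitCriterion_holds : LandherrSplitCriterion :=
  landherrSplitCriterion_of_hyperbolicOfSplitDiscriminant landherrHyperbolicOfSplitDiscriminant_holds

/-! ## §2 The node's own rows, binder-free -/

/-- **W4 EXACT, FACT-FREE**: the split rung `SplitWeilAbelianVarieties` IS the conjunction of the split cells
`(n, d, (-1)ⁿ)`, `n ≥ 4` (XXVIII `splitWeilAbelianVarieties_iff_split_components_of_converse` with its binder discharged).
[cite: vanGeemen1994HodgeAV, 5.4 and (5.4.1)] [cite: Markman2025SurveySecant, §12] -/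
theorem splitWeilAbelianVarieties_iff_split_components' :
    SplitWeilAbelianVarieties ↔
      ∀ (n : ℕ), 4 ≤ n → ∀ (d : ℕ), 0 < d → WeilClassesComponent n d (splitDiscriminantClass n d) :=
  splitWeilAbelianVarieties_iff_split_components_of_converse landherrHyperbolicOfSplitDiscriminant_holds

/-- **F2 EXACT, FACT-FREE**: Markman's hyperbolic-sixfold statement ⟺ all split sixfold cells `(3, d, -1)`.
[cite: Markman2025SecantWeil, Thm. 1.5.1 (preprint, unrefereed)] [cite: vanGeemen1994HodgeAV, 5.4 and (5.4.1)] -/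
theorem hyperbolicSixfolds_iff_split_components' :
    Markman2025_weilClasses_algebraic_hyperbolicSixfold ↔
      ∀ (d : ℕ), 0 < d → WeilClassesComponent 3 d (splitDiscriminantClass 3 d) :=
  hyperbolicSixfolds_iff_split_components_of_converse landherrHyperbolicOfSplitDiscriminant_holds

/-- The split fourfold cells `(2, d, +1)` from Markman JEMS 2023 Thm. 1.3 ALONE (refereed named fact, binder `hM`; no
Landherr binder). [cite: Markman2023GeneralizedKummers, Thm. 1.3] [cite: vanGeemen1994HodgeAV, (5.4.1)] -/
theorem weilClassesComponent_split_two_of_markman2023' (hM : Markman2023_weilClasses_algebraic_discOneWeilFourfold)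
    {d : ℕ} (hd : 0 < d) : WeilClassesComponent 2 d (splitDiscriminantClass 2 d) :=
  weilClassesComponent_split_two_of_markman2023_of_converse landherrHyperbolicOfSplitDiscriminant_holds hM hd

/-- The split sixfold cell `(3, 3, -1)` from Schoen 1988/1998 ALONE (refereed named fact `hS`).
[cite: Schoen1998HodgeWeilAddendum] [cite: vanGeemen1994HodgeAV, 7.3 and (5.4.1)] -/
theorem weilClassesComponent_split_three_three_of_schoen' (hS : Schoen1998_weilClasses_algebraic_hyperbolicSixfold_three) :
    WeilClassesComponent 3 3 (splitDiscriminantClass 3 3) :=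
  weilClassesComponent_split_three_three_of_schoen_of_converse landherrHyperbolicOfSplitDiscriminant_holds hS

/-- The split sixfold cell `(3, 1, -1)` from Koike 2004 ALONE (refereed named fact `hK`).
[cite: Koike2004WeilHodge, Thm. 2.1 and Cor. 2.1] [cite: vanGeemen1994HodgeAV, (5.4.1)] -/
theorem weilClassesComponent_split_three_one_of_koike' (hK : Koike2004_weilClasses_algebraic_hyperbolicSixfold_one) :
    WeilClassesComponent 3 1 (splitDiscriminantClass 3 1) :=
  weilClassesComponent_split_three_one_of_koike_of_converse landherrHyperbolicOfSplitDiscriminant_holds hK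

/-- The split sixfold cells `(3, d, -1)` from Markman's hyperbolic-sixfold statement ALONE (UNREFEREED named fact `hM`).
[cite: Markman2025SecantWeil, Thm. 1.5.1 (preprint, unrefereed)] [cite: vanGeemen1994HodgeAV, (5.4.1)] -/
theorem weilClassesComponent_split_three_of_markmanSixfolds' (hM : Markman2025_weilClasses_algebraic_hyperbolicSixfold)
    {d : ℕ} (hd : 0 < d) : WeilClassesComponent 3 d (splitDiscriminantClass 3 d) :=
  weilClassesComponent_split_three_of_markmanSixfolds_of_converse landherrHyperbolicOfSplitDiscriminant_holds hM hd

/-- **ab-weil-1's R1′ row with its Landherr binder discharged**: the non-split sixfold rung `NonsplitSixfolds` follows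
from the NEGATIVE non-split sixfold cells `(3, d, δ)`, `δ ≠ [-1]`, `sign δ = -1`, ALONE
(`Ring2AbelianAllWeilSignCells.nonsplitSixfolds_of_negative_nonsplit_components_of_converse`).
[cite: vanGeemen1994HodgeAV, Lemma 5.2 and (5.4.1)] [cite: Landherr1936HermitianForms] -/
theorem nonsplitSixfolds_of_negative_nonsplit_components'
    (h : ∀ d : ℕ, 0 < d → ∀ δ : weilNormResidueGroup d, δ ≠ splitDiscriminantClass 3 d → weilSign d δ = -1 →
      WeilClassesComponent 3 d δ) :
    NonsplitSixfolds :=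
  nonsplitSixfolds_of_negative_nonsplit_components_of_converse landherrHyperbolicOfSplitDiscriminant_holds h

/-! ## §3 Split Weil type ⟺ discriminant `(-1)ⁿ` (van Geemen (5.4.1) on the tree's predicates) -/

/-- **SPLIT ⟺ discriminant `[(-1)ⁿ]`** for an abelian variety of Weil type `(n, d)` (`HodgeTheory.IsWeilType`):
`IsSplitWeilType A φ n d` (some `K`-symmetrised hyperplane class `h_K = d·e^*a + φ^*e^*a`, `a ≠ 0` rational, is
hyperbolic) iff some such `h_K` has a NON-DEGENERATE discriminant witness of class `[(-1)ⁿ]`. (→ lit's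
`IsSplitWeilType.exists_hasWeilDiscriminantNondeg_neg_one_pow`; ← Landherr,
`IsWeilType.isSplitWeilType_of_hasWeilDiscriminantNondeg_split`.) [cite: vanGeemen1994HodgeAV, 5.4 and (5.4.1)]
[cite: Landherr1936HermitianForms] [cite: Markman2025SurveySecant, §11.5 Step 1] -/
theorem isSplitWeilType_iff_exists_hasWeilDiscriminantNondeg_split {A : AbelianVariety ℂ} {φ : A ⟶ A} {n d : ℕ}
    (hW : IsWeilType A φ n d) :
    IsSplitWeilType A φ n d ↔
      ∃ (e : ProjectiveEmbedding A.X) (a : complexBetti (projectiveSpace e.n ℂ) 2),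
        IsRationalClass a ∧ a ≠ 0 ∧
          HasWeilDiscriminantNondeg A φ n d
            ((d : ℂ) • complexBetti.map e.ι 2 a + complexBetti.map φ.hom.hom.hom 2 (complexBetti.map e.ι 2 a))
            (QuotientGroup.mk ((-1 : ℚˣ) ^ n)) :=
  ⟨fun h ↦ VanGeemen1994.IsSplitWeilType.exists_hasWeilDiscriminantNondeg_neg_one_pow h,
    fun ⟨e, _, ha, ha0, hδ⟩ ↦
      VanGeemen1994.IsWeilType.isSplitWeilType_of_hasWeilDiscriminantNondeg_split hW e ha ha0 hδ⟩

/-- **Non-split Weil type ⟹ every `K`-symmetrised hyperplane class has discriminant `≠ [(-1)ⁿ]`** (contrapositive of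
Landherr on the carriers; the NON-split components are exactly the components `δ ≠ (-1)ⁿ`, Markman §11.5 Step 1 "if and
only if", now both directions in the tree). [cite: vanGeemen1994HodgeAV, 5.4 and (5.4.1)] [cite: Markman2025SurveySecant, §11.5 Step 1] -/
theorem IsNonsplitWeilType.ne_split_of_hasWeilDiscriminantNondeg {A : AbelianVariety ℂ} {φ : A ⟶ A} {n d : ℕ}
    (hN : IsNonsplitWeilType A φ n d) (e : ProjectiveEmbedding A.X) {a : complexBetti (projectiveSpace e.n ℂ) 2}
    (ha : IsRationalClass a) (ha0 : a ≠ 0) {δ : weilNormResidueGroup d}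
    (hδ : HasWeilDiscriminantNondeg A φ n d
      ((d : ℂ) • complexBetti.map e.ι 2 a + complexBetti.map φ.hom.hom.hom 2 (complexBetti.map e.ι 2 a)) δ) :
    δ ≠ QuotientGroup.mk ((-1 : ℚˣ) ^ n) := by
  have hW := hN.isWeilType
  obtain ⟨c, hcw, hc0, hcr⟩ := exists_isRationalClass_ne_zero_mem_weilClassesOf hW.pos hW.dim_eq hW.d_pos hW.sq_eq
  rintro rfl
  exact hN.2 e a ha ha0 (isHyperbolicWeilType_of_hasWeilDiscriminantNondeg_split hW.pos hW.dim_eq hW.d_pos hW.sq_eq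
    e ha ha0 ⟨c, hcw, hcr, hW.isOfHodgeType_of_mem_weilClassesOf hcw, hc0⟩ hδ)

end Summit.HodgeConjecture.HodgeConjecture.Ring2.AbelianAll

end
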